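import Summits.HodgeConjecture.CorCM.IrreducibleOddWeightsIndexParityAbsorption
import HarnessLib

/-!
# Index scaling (CM fields): the shadow `m·w` of any shadow at index `f` is a shadow at every index `m f + 2d`;
# `S(m·w) = S(w)` ⟹ defects TRANSFER ACROSS THE PARITY of the index; additivity at an EVEN index `F` descends to
# every index `≤ F/2`; interaction at an odd index `f` reappears at EVERY index `≥ 2f`

COR-CM (cell `pub-hodgecm2`, binder seat `b16` gen 69, count-neutral claim ROW SPACES OVER THE COMMUTANT ∕ THE
INDEX-SCALING LAW, file S1; theorems only, no definition, no named fact, no `sorry`).  NEW as stated, hence under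
`Summits/`.  HONEST FRAMING: Galois theory of CM fields inside `ℂ` and finite combinatorics of CM types, with consequences
for `dim MT(A₀ × A₁)` of abelian varieties with complex multiplication (Kubota–Dodson rank = `dim MT`, Pohlmann);
nothing is claimed about the algebraicity of Hodge classes; `HC_CM` is neither used nor asserted.

SETTING (gen 68 P2/P4, `IrreducibleOddWeightsIndexParityCMFields` / `…Absorption`).  CM fields `K_{i₀} ⊇ T`,
`K′_{i₀} ⊇ T` over a common subfield `T` without real embeddings, both containing the traces of the (isomorphic) partners
`K_{i₁} ≅ K′_{i₁}` (TR); `f = [K_{i₀}:T]`, `f′ = [K′_{i₀}:T]`; the SHADOW of a type `Φ₀` on `Hom(T, ℂ)` is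
`w₀(y) = #(Φ₀ ∩ res⁻¹y) − #(Φ̄₀ ∩ res⁻¹y)`; the DEFECT `dim Hg(A₀)+dim Hg(A₁)−dim Hg(A₀×A₁) = dim(S(w₀) ∩ MC₁)` (P2).
Gen 68 proved PADDING (`f = f′ + 2d` ⟹ every shadow at index `f′` is a shadow at index `f`) and hence monotone
defect spectra WITHIN A PARITY CLASS of the index.  THIS FILE: SCALING.

* §1 `span{m·c_y} = span{c_y}` for `m ≠ 0` (`span_range_smul_eq_of_ne_zero`); **SCALED SHADOW ⟹ SAME DEFECT**
  (`cmTypeRank_add_cmFamilyRank_eq_of_shadow_eq_smul_of_ringEquiv`): if `w₀ = m·w₀′` with `m ≠ 0` then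
  `dim Hg(A₀)+dim Hg(A₁)−dim Hg(A₀×A₁) = dim Hg(A₀′)+dim Hg(A₁)−dim Hg(A₀′×A₁)`.
* §2 **SCALING SURJECTIVITY** (`exists_cmType_shadow_eq_smul_of_finrank_eq`): `f = m f′ + 2d` ⟹ for every type `Φ₀′`
  of `K′_{i₀}` there is a type `Φ₀` of `K_{i₀}` with shadow `m·w₀′` (fibre counts `m·k′(y) + d`).  With `m = 2` the index
  `f` is EVEN whatever the parity of `f′`: even indices realise (the doubles of) ALL odd-index shadows.
* §3 **DEFECT TRANSFER AND DESCENT** (`exists_defect_eq_of_finrank_eq_mul_add`,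
  `forall_additive_of_forall_additive_of_finrank_eq_mul_add`): `f = m f′ + 2d`, `m ≥ 1` ⟹ every defect realised at index
  `f′` is realised at index `f`; additivity for ALL types at index `f` DESCENDS to index `f′`.  Parity-free forms
  (`exists_defect_eq_of_even_of_two_mul_le`, **`forall_additive_of_forall_additive_of_even_of_two_mul_le`**): `f` EVEN
  and `2f′ ≤ f` suffice — **`Hg(A₀ × A₁) = Hg(A₀) × Hg(A₁)` for all types at an even index `F` forces the same at EVERY
  index `≤ F/2` and every even index `≤ F`**; contrapositively an interacting pair at an ODD index `f′` yields interacting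
  pairs at every index `≥ 2f′` (odd ones `≥ f′` by padding).  The only asymmetry left is genuine: even-entry shadows
  never scale to odd entries, so even-index phenomena (gen 68's twisted types) need not descend to odd indices.
  NUMERICS (this generation's shadow census, not a theorem): for the `GL₂(𝔽₃)` (8,8) twins the indices `(1,2), (2,1),
  (4,1)` are additive and `(3,1), (5,1), (6,1), (2,2)` interact (defect 4), the first even witness being the DOUBLE
  `(2,−6,−2,−2)` of the index-3 witness `(1,−3,−1,−1)` — gen 68's «parity-3 law» was a small-box effect of exactly this
  scaling; for the D₄ (4,4) twins odd × odd indices stay additive through index `(7,3)` while every even index interacts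
  (gen 68's 2-adic obstruction).

## References

* [Gordon1999HodgeAVSurvey] B. B. Gordon, *A survey of the Hodge conjecture for abelian varieties*, §3 Theorem (Imai,
  Murty) with proof, 7.5–7.7, 9.4.3 (Yanai).
* [Dodson1987] B. Dodson, J. Algebra 111 (1987), §1.1 (rank, lifted types).
* [Shimura1998] G. Shimura, *Abelian Varieties with Complex Multiplication and Modular Functions*, §8.1, §18.1.
* [Lang2002] S. Lang, *Algebra*, 3rd ed., VI §1 Thm. 1.1, Cor. 1.6.
-/

set_option autoImplicit false

noncomputable section

open scoped BigOperators Classical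

open CategoryTheory CategoryTheory.Limits NumberField Module IntermediateField

namespace Summit.HodgeConjecture.CorCM

open Literature.NumberTheory.ComplexMultiplication
open Literature.AlgebraicGeometry.Motives (AbelianVariety CMType)
open Literature.AlgebraicGeometry.Motives.AbelianVariety
open Literature.AlgebraicGeometry.HodgeTheory
open Literature.AlgebraicGeometry.ComplexMultiplication (IsCMTypeRealisation)
open Literature.AlgebraicGeometry.Pohlmann1968

/-! ### §1 Scaling a family of vectors does not change its span; scaled shadow ⟹ same defect -/

section Smul

variable {Y : Type*} {M : Type*} [AddCommGroup M] [Module ℚ M]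

/-- `span{m·c_y : y} = span{c_y : y}` for a non-zero scalar `m`. [folklore] -/
theorem span_range_smul_eq_of_ne_zero (c : Y → M) {m : ℚ} (hm : m ≠ 0) :
    Submodule.span ℚ (Set.range fun y : Y => m • c y) = Submodule.span ℚ (Set.range c) := by
  refine le_antisymm (Submodule.span_le.2 ?_) (Submodule.span_le.2 ?_)
  · rintro _ ⟨y, rfl⟩
    exact Submodule.smul_mem _ m (Submodule.subset_span ⟨y, rfl⟩)
  · rintro _ ⟨y, rfl⟩
    have h : c y = m⁻¹ • (m • c y) := by rw [smul_smul, inv_mul_cancel₀ hm, one_smul]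
    rw [h]
    exact Submodule.smul_mem _ m⁻¹ (Submodule.subset_span ⟨y, rfl⟩)

end Smul

section Defect

variable {I : Type} [Fintype I] {K : I → Type} [∀ i, Field (K i)] [∀ i, NumberField (K i)] [∀ i, IsCMField (K i)]
  {K' : I → Type} [∀ i, Field (K' i)] [∀ i, NumberField (K' i)] [∀ i, IsCMField (K' i)] {T : Type} [Field T]

/-- **SCALED SHADOW ⟹ SAME DEFECT, ACROSS FIELDS**: two pairs `(K_{i₀}, K_{i₁})`, `(K′_{i₀}, K′_{i₁})` with
`K′_{i₁} ≅ K_{i₁}` and corresponding partner types, subfields `T ⊆ K_{i₀}`, `T ⊆ K′_{i₀}` both containing the traces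
(TR), and slot-`i₀` types whose shadows on `T` are PROPORTIONAL, `w₀ = m·w₀′` with `m ≠ 0`:
`cmTypeRank Φ₀ + cmFamilyRank Φ′ = cmTypeRank Φ₀′ + cmFamilyRank Φ` — the defects
`dim Hg(A₀)+dim Hg(A₁)−dim Hg(A₀×A₁)` and `dim Hg(A₀′)+dim Hg(A₁)−dim Hg(A₀′×A₁)` coincide, because the
shadow-coefficient spaces `S(m·w) = S(w)` do. [cite: Gordon1999HodgeAVSurvey, §3 Theorem, 7.5–7.7 and 9.4.3] -/
theorem cmTypeRank_add_cmFamilyRank_eq_of_shadow_eq_smul_of_ringEquiv {i₀ i₁ : I} (h01 : i₀ ≠ i₁)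
    (hI : ∀ l, l = i₀ ∨ l = i₁) (Φ : ∀ i, CMType (K i)) (Φ' : ∀ i, CMType (K' i)) [Algebra T (K i₀)]
    [Algebra T (K' i₀)] (e : K' i₁ ≃+* K i₁)
    (hΦ₁ : ∀ t : K i₁ →+* ℂ, t ∈ (Φ i₁).1 ↔ t.comp e.toRingHom ∈ (Φ' i₁).1)
    (htr : ∀ (a : K i₀ →+* ℂ) (k : K i₀), a k ∈ normalClosure ℚ (K i₁) ℂ → k ∈ Set.range (algebraMap T (K i₀)))
    (htr' : ∀ (a : K' i₀ →+* ℂ) (k : K' i₀), a k ∈ normalClosure ℚ (K' i₁) ℂ →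
      k ∈ Set.range (algebraMap T (K' i₀)))
    {m : ℚ} (hm : m ≠ 0)
    (hw : ∀ y : T →+* ℂ,
      ∑ t ∈ Finset.univ.filter (fun t : K i₀ →+* ℂ => t.comp (algebraMap T (K i₀)) = y),
          antiVec (Φ i₀).1 (1 : ℂ ≃+* ℂ) t =
        m * ∑ t ∈ Finset.univ.filter (fun t : K' i₀ →+* ℂ => t.comp (algebraMap T (K' i₀)) = y),
          antiVec (Φ' i₀).1 (1 : ℂ ≃+* ℂ) t) :
    cmTypeRank (Φ i₀) + CMAlgebra.cmFamilyRank Φ' = cmTypeRank (Φ' i₀) + CMAlgebra.cmFamilyRank Φ := by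
  have h := cmTypeRank_add_cmTypeRank_eq_cmFamilyRank_add_one_add_finrank_shadow_inf h01 hI Φ htr
  have h' := cmTypeRank_add_cmTypeRank_eq_cmFamilyRank_add_one_add_finrank_shadow_inf h01 hI Φ' htr'
  rw [span_coeff_eq_of_ringEquiv e (Φ i₁) (Φ' i₁) hΦ₁] at h'
  have hS : (fun y : T →+* ℂ => fun g : ℂ ≃+* ℂ =>
      ∑ t ∈ Finset.univ.filter (fun t : K i₀ →+* ℂ => t.comp (algebraMap T (K i₀)) = g • y),
        antiVec (Φ i₀).1 (1 : ℂ ≃+* ℂ) t) =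
      fun y : T →+* ℂ => m • fun g : ℂ ≃+* ℂ =>
        ∑ t ∈ Finset.univ.filter (fun t : K' i₀ →+* ℂ => t.comp (algebraMap T (K' i₀)) = g • y),
          antiVec (Φ' i₀).1 (1 : ℂ ≃+* ℂ) t := by
    funext y
    funext g
    rw [Pi.smul_apply, smul_eq_mul]
    exact hw (g • y)
  rw [hS, span_range_smul_eq_of_ne_zero _ hm] at h
  -- the partner ranks agree
  have hr : cmTypeRank (Φ' i₁) = cmTypeRank (Φ i₁) := by
    change typeRank (ℂ ≃+* ℂ) (Φ' i₁).1 = typeRank (ℂ ≃+* ℂ) (Φ i₁).1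
    rw [(isCMTypeWith_conj (Φ' i₁)).typeRank_eq_finrank_antiSpan_add_one,
      (isCMTypeWith_conj (Φ i₁)).typeRank_eq_finrank_antiSpan_add_one,
      IrrOdd.finrank_antiSpan_eq_finrank_span_coeff, IrrOdd.finrank_antiSpan_eq_finrank_span_coeff,
      span_coeff_eq_of_ringEquiv e (Φ i₁) (Φ' i₁) hΦ₁]
  omega

end Defect

/-! ### §2 Scaling surjectivity: `[K₀ : T] = m·[K₀′ : T] + 2d` ⟹ `m·w′` is a shadow of `K₀` -/

section Scaling

variable {K₀ : Type} [Field K₀] [NumberField K₀] [IsCMField K₀] {T : Type} [Field T] [NumberField T] [Algebra T K₀]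

/-- **SCALING SURJECTIVITY**: `T` without real embeddings, `K₀, K₀′ ⊇ T` CM fields with `[K₀:T] = m·[K₀′:T] + 2d`.
For every CM type `Φ₀′` of `K₀′` there is a CM type `Φ₀` of `K₀` whose shadow on `T` is `m` TIMES the shadow of `Φ₀′`
(fibre counts `m·#(Φ₀′ ∩ res⁻¹y) + d`).  For `m = 1` this is gen 68's padding; for `m = 2` the index `[K₀:T]` is even
WHATEVER the parity of `[K₀′:T]`. [cite: Gordon1999HodgeAVSurvey, 9.4.3] [cite: Dodson1987, §1.1] -/
theorem exists_cmType_shadow_eq_smul_of_finrank_eq [IsTotallyComplex T] {K₀' : Type} [Field K₀'] [NumberField K₀']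
    [IsCMField K₀'] [Algebra T K₀'] (Φ₀' : CMType K₀') {m d : ℕ}
    (hmd : Module.finrank T K₀ = m * Module.finrank T K₀' + 2 * d) :
    ∃ Φ₀ : CMType K₀, ∀ y : T →+* ℂ,
      ∑ t ∈ Finset.univ.filter (fun t : K₀ →+* ℂ => t.comp (algebraMap T K₀) = y), antiVec Φ₀.1 (1 : ℂ ≃+* ℂ) t =
        (m : ℚ) * ∑ t ∈ Finset.univ.filter (fun t : K₀' →+* ℂ => t.comp (algebraMap T K₀') = y),
          antiVec Φ₀'.1 (1 : ℂ ≃+* ℂ) t := by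
  -- fibre counts of `Φ₀′`
  set k' : (T →+* ℂ) → ℕ := fun y =>
    (Finset.univ.filter (fun t : K₀' →+* ℂ => t.comp (algebraMap T K₀') = y ∧ t ∈ Φ₀'.1)).card with hk'
  have hk'sum : ∀ y : T →+* ℂ, k' y + k' ((starRingAut : ℂ ≃+* ℂ) • y) = Module.finrank T K₀' := fun y =>
    card_fibre_inter_add_card_fibre_inter_conj Φ₀' y
  -- the scaled counts
  obtain ⟨Φ₀, hΦ₀⟩ := exists_cmType_forall_shadow_eq (K₀ := K₀) (fun y => m * k' y + d) fun y => by
    have h := hk'sum y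
    calc m * k' y + d + (m * k' ((starRingAut : ℂ ≃+* ℂ) • y) + d)
        = m * (k' y + k' ((starRingAut : ℂ ≃+* ℂ) • y)) + 2 * d := by ring
      _ = Module.finrank T K₀ := by rw [h, hmd]
  refine ⟨Φ₀, fun y => ?_⟩
  rw [hΦ₀ y]
  have hw' := IrrOdd.fibre_shadow_eq_two_mul_card_sub_card (G := ℂ ≃+* ℂ) Φ₀'.1
    (fun t : K₀' →+* ℂ => t.comp (algebraMap T K₀')) y
  beta_reduce at hw'
  rw [hw', card_fibre_comp_algebraMap, hmd]
  push_cast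
  ring

end Scaling

/-! ### §3 Defect transfer and descent across the parity of the index -/

section Transfer

variable {I : Type} [Fintype I] {K : I → Type} [∀ i, Field (K i)] [∀ i, NumberField (K i)] [∀ i, IsCMField (K i)]
  {K' : I → Type} [∀ i, Field (K' i)] [∀ i, NumberField (K' i)] [∀ i, IsCMField (K' i)] {T : Type} [Field T]
  [NumberField T]

/-- **DEFECT TRANSFER `f′ ↦ m f′ + 2d`**: pairs `(K_{i₀}, K_{i₁})`, `(K′_{i₀}, K′_{i₁})` with `K′_{i₁} ≅ K_{i₁}`
(corresponding partner types), a common subfield `T` without real embeddings containing both traces (TR), and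
**`[K_{i₀}:T] = m·[K′_{i₀}:T] + 2d` with `m ≥ 1`**.  Then EVERY defect realised by a type of `K′_{i₀}` is realised by a
type of `K_{i₀}` (with shadow `m·w′`): for every `Φ′` there is `Φ₀` with
`cmTypeRank Φ₀ + cmFamilyRank Φ′ = cmTypeRank Φ′_{i₀} + cmFamilyRank (Φ with slot i₀ replaced by Φ₀)`.
Gen 68 P4 `exists_defect_eq_of_finrank_eq_add` is `m = 1`; `m = 2` crosses the parity of the index.
[cite: Gordon1999HodgeAVSurvey, §3 Theorem, 7.5–7.7 and 9.4.3] [cite: Dodson1987, §1.1] -/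
theorem exists_defect_eq_of_finrank_eq_mul_add {i₀ i₁ : I} (h01 : i₀ ≠ i₁) (hI : ∀ l, l = i₀ ∨ l = i₁)
    (Φ : ∀ i, CMType (K i)) (Φ' : ∀ i, CMType (K' i)) [Algebra T (K i₀)] [Algebra T (K' i₀)] [IsTotallyComplex T]
    (e : K' i₁ ≃+* K i₁) (hΦ₁ : ∀ t : K i₁ →+* ℂ, t ∈ (Φ i₁).1 ↔ t.comp e.toRingHom ∈ (Φ' i₁).1)
    (htr : ∀ (a : K i₀ →+* ℂ) (k : K i₀), a k ∈ normalClosure ℚ (K i₁) ℂ → k ∈ Set.range (algebraMap T (K i₀)))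
    (htr' : ∀ (a : K' i₀ →+* ℂ) (k : K' i₀), a k ∈ normalClosure ℚ (K' i₁) ℂ →
      k ∈ Set.range (algebraMap T (K' i₀)))
    {m d : ℕ} (hm : 1 ≤ m) (hmd : Module.finrank T (K i₀) = m * Module.finrank T (K' i₀) + 2 * d) :
    ∃ Φ₀ : CMType (K i₀), cmTypeRank Φ₀ + CMAlgebra.cmFamilyRank Φ' =
      cmTypeRank (Φ' i₀) + CMAlgebra.cmFamilyRank (Function.update Φ i₀ Φ₀) := by
  obtain ⟨Φ₀, hΦ₀⟩ := exists_cmType_shadow_eq_smul_of_finrank_eq (K₀ := K i₀) (Φ' i₀) hmd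
  refine ⟨Φ₀, ?_⟩
  have hm0 : (m : ℚ) ≠ 0 := by exact_mod_cast (show m ≠ 0 by omega)
  have h := cmTypeRank_add_cmFamilyRank_eq_of_shadow_eq_smul_of_ringEquiv h01 hI (Function.update Φ i₀ Φ₀) Φ' e
    (by rw [Function.update_of_ne h01.symm]; exact hΦ₁) htr htr' hm0
    (by rw [Function.update_self]; exact hΦ₀)
  rw [Function.update_self] at h
  exact h

/-- **ADDITIVITY FOR ALL TYPES DESCENDS `m f′ + 2d ↦ f′`**: in the situation above, if
`Hg(A₀ × A₁) = Hg(A₀) × Hg(A₁)` for EVERY CM type of `K_{i₀}` against the partner type, then also for every CM type of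
`K′_{i₀}` against the corresponding partner type. [cite: Gordon1999HodgeAVSurvey, §3 Theorem, 7.5–7.7 and 9.4.3]
[cite: Dodson1987, §1.1] -/
theorem forall_additive_of_forall_additive_of_finrank_eq_mul_add {i₀ i₁ : I} (h01 : i₀ ≠ i₁)
    (hI : ∀ l, l = i₀ ∨ l = i₁) (Φ : ∀ i, CMType (K i)) (Φ' : ∀ i, CMType (K' i)) [Algebra T (K i₀)]
    [Algebra T (K' i₀)] [IsTotallyComplex T] (e : K' i₁ ≃+* K i₁)
    (hΦ₁ : ∀ t : K i₁ →+* ℂ, t ∈ (Φ i₁).1 ↔ t.comp e.toRingHom ∈ (Φ' i₁).1)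
    (htr : ∀ (a : K i₀ →+* ℂ) (k : K i₀), a k ∈ normalClosure ℚ (K i₁) ℂ → k ∈ Set.range (algebraMap T (K i₀)))
    (htr' : ∀ (a : K' i₀ →+* ℂ) (k : K' i₀), a k ∈ normalClosure ℚ (K' i₁) ℂ →
      k ∈ Set.range (algebraMap T (K' i₀)))
    {m d : ℕ} (hm : 1 ≤ m) (hmd : Module.finrank T (K i₀) = m * Module.finrank T (K' i₀) + 2 * d)
    (hAA : ∀ Φ₀ : CMType (K i₀), CMAlgebra.cmFamilyRank (Function.update Φ i₀ Φ₀) + Fintype.card I =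
      (∑ i, cmTypeRank (Function.update Φ i₀ Φ₀ i)) + 1) :
    CMAlgebra.cmFamilyRank Φ' + Fintype.card I = (∑ i, cmTypeRank (Φ' i)) + 1 := by
  obtain ⟨Φ₀, h⟩ := exists_defect_eq_of_finrank_eq_mul_add h01 hI Φ Φ' e hΦ₁ htr htr' hm hmd
  have hA := hAA Φ₀
  rw [IrrOdd.sum_eq_add_of_pair _ hI h01, Function.update_self, Function.update_of_ne h01.symm] at hA
  rw [IrrOdd.sum_eq_add_of_pair _ hI h01]
  have hr : cmTypeRank (Φ' i₁) = cmTypeRank (Φ i₁) := by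
    change typeRank (ℂ ≃+* ℂ) (Φ' i₁).1 = typeRank (ℂ ≃+* ℂ) (Φ i₁).1
    rw [(isCMTypeWith_conj (Φ' i₁)).typeRank_eq_finrank_antiSpan_add_one,
      (isCMTypeWith_conj (Φ i₁)).typeRank_eq_finrank_antiSpan_add_one,
      IrrOdd.finrank_antiSpan_eq_finrank_span_coeff, IrrOdd.finrank_antiSpan_eq_finrank_span_coeff,
      span_coeff_eq_of_ringEquiv e (Φ i₁) (Φ' i₁) hΦ₁]
  omega

/-- Arithmetic of the parity-free form: `F` even and `2f′ ≤ F` ⟹ `F = m f′ + 2d` with `m ∈ {1, 2}` according to the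
parity of `f′`. [folklore] -/
theorem exists_eq_mul_add_two_mul_of_even_of_two_mul_le {F f' : ℕ} (hF : Even F) (hle : 2 * f' ≤ F) :
    ∃ m d : ℕ, 1 ≤ m ∧ F = m * f' + 2 * d := by
  obtain ⟨a, ha⟩ := hF
  rcases Nat.even_or_odd f' with ⟨b, hb⟩ | ⟨b, hb⟩
  · exact ⟨1, a - b, le_refl 1, by omega⟩
  · exact ⟨2, a - f', by norm_num, by omega⟩

/-- **DEFECT TRANSFER, PARITY-FREE FORM**: `[K_{i₀}:T]` EVEN and `2·[K′_{i₀}:T] ≤ [K_{i₀}:T]` ⟹ every defect realised by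
a type of `K′_{i₀}` is realised by a type of `K_{i₀}` — whatever the parity of `[K′_{i₀}:T]`.
[cite: Gordon1999HodgeAVSurvey, §3 Theorem, 7.5–7.7 and 9.4.3] [cite: Dodson1987, §1.1] -/
theorem exists_defect_eq_of_even_of_two_mul_le {i₀ i₁ : I} (h01 : i₀ ≠ i₁) (hI : ∀ l, l = i₀ ∨ l = i₁)
    (Φ : ∀ i, CMType (K i)) (Φ' : ∀ i, CMType (K' i)) [Algebra T (K i₀)] [Algebra T (K' i₀)] [IsTotallyComplex T]
    (e : K' i₁ ≃+* K i₁) (hΦ₁ : ∀ t : K i₁ →+* ℂ, t ∈ (Φ i₁).1 ↔ t.comp e.toRingHom ∈ (Φ' i₁).1)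
    (htr : ∀ (a : K i₀ →+* ℂ) (k : K i₀), a k ∈ normalClosure ℚ (K i₁) ℂ → k ∈ Set.range (algebraMap T (K i₀)))
    (htr' : ∀ (a : K' i₀ →+* ℂ) (k : K' i₀), a k ∈ normalClosure ℚ (K' i₁) ℂ →
      k ∈ Set.range (algebraMap T (K' i₀)))
    (heven : Even (Module.finrank T (K i₀))) (hle : 2 * Module.finrank T (K' i₀) ≤ Module.finrank T (K i₀)) :
    ∃ Φ₀ : CMType (K i₀), cmTypeRank Φ₀ + CMAlgebra.cmFamilyRank Φ' =
      cmTypeRank (Φ' i₀) + CMAlgebra.cmFamilyRank (Function.update Φ i₀ Φ₀) := by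
  obtain ⟨m, d, hm, hmd⟩ := exists_eq_mul_add_two_mul_of_even_of_two_mul_le heven hle
  exact exists_defect_eq_of_finrank_eq_mul_add h01 hI Φ Φ' e hΦ₁ htr htr' hm hmd

/-- **ADDITIVITY AT AN EVEN INDEX DESCENDS TO EVERY INDEX AT MOST HALF OF IT**: pairs `(K_{i₀}, K_{i₁})`,
`(K′_{i₀}, K′_{i₁})` as above, `[K_{i₀}:T]` EVEN, `2·[K′_{i₀}:T] ≤ [K_{i₀}:T]`.  If `Hg(A₀ × A₁) = Hg(A₀) × Hg(A₁)` for
every CM type of `K_{i₀}` (against the partner type), then the same holds for every CM type of `K′_{i₀}` — WHATEVER THE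
PARITY of `[K′_{i₀}:T]`.  Contrapositive (the census reading): an interacting type pair at an ODD index `f′` produces
interacting pairs at every index `≥ 2f′`. [cite: Gordon1999HodgeAVSurvey, §3 Theorem, 7.5–7.7 and 9.4.3]
[cite: Dodson1987, §1.1] -/
theorem forall_additive_of_forall_additive_of_even_of_two_mul_le {i₀ i₁ : I} (h01 : i₀ ≠ i₁)
    (hI : ∀ l, l = i₀ ∨ l = i₁) (Φ : ∀ i, CMType (K i)) (Φ' : ∀ i, CMType (K' i)) [Algebra T (K i₀)]
    [Algebra T (K' i₀)] [IsTotallyComplex T] (e : K' i₁ ≃+* K i₁)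
    (hΦ₁ : ∀ t : K i₁ →+* ℂ, t ∈ (Φ i₁).1 ↔ t.comp e.toRingHom ∈ (Φ' i₁).1)
    (htr : ∀ (a : K i₀ →+* ℂ) (k : K i₀), a k ∈ normalClosure ℚ (K i₁) ℂ → k ∈ Set.range (algebraMap T (K i₀)))
    (htr' : ∀ (a : K' i₀ →+* ℂ) (k : K' i₀), a k ∈ normalClosure ℚ (K' i₁) ℂ →
      k ∈ Set.range (algebraMap T (K' i₀)))
    (heven : Even (Module.finrank T (K i₀))) (hle : 2 * Module.finrank T (K' i₀) ≤ Module.finrank T (K i₀))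
    (hAA : ∀ Φ₀ : CMType (K i₀), CMAlgebra.cmFamilyRank (Function.update Φ i₀ Φ₀) + Fintype.card I =
      (∑ i, cmTypeRank (Function.update Φ i₀ Φ₀ i)) + 1) :
    CMAlgebra.cmFamilyRank Φ' + Fintype.card I = (∑ i, cmTypeRank (Φ' i)) + 1 := by
  obtain ⟨m, d, hm, hmd⟩ := exists_eq_mul_add_two_mul_of_even_of_two_mul_le heven hle
  exact forall_additive_of_forall_additive_of_finrank_eq_mul_add h01 hI Φ Φ' e hΦ₁ htr htr' hm hmd hAA

/-- **INTERACTION ASCENDS FROM AN ODD INDEX TO EVERY LARGER INDEX OF EITHER PARITY**: if some CM type of `K′_{i₀}`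
INTERACTS with the partner type (`dim Hg(A₀′ × A₁) < dim Hg(A₀′) + dim Hg(A₁)`), and `[K_{i₀}:T] = m·[K′_{i₀}:T] + 2d`
with `m ≥ 1` (e.g. `[K_{i₀}:T]` even `≥ 2[K′_{i₀}:T]`, or of the same parity and `≥ [K′_{i₀}:T]`), then some CM type of
`K_{i₀}` interacts with the partner type, with the SAME defect. [cite: Gordon1999HodgeAVSurvey, §3 Theorem, 7.5–7.7] -/
theorem exists_lt_of_lt_of_finrank_eq_mul_add {i₀ i₁ : I} (h01 : i₀ ≠ i₁) (hI : ∀ l, l = i₀ ∨ l = i₁)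
    (Φ : ∀ i, CMType (K i)) (Φ' : ∀ i, CMType (K' i)) [Algebra T (K i₀)] [Algebra T (K' i₀)] [IsTotallyComplex T]
    (e : K' i₁ ≃+* K i₁) (hΦ₁ : ∀ t : K i₁ →+* ℂ, t ∈ (Φ i₁).1 ↔ t.comp e.toRingHom ∈ (Φ' i₁).1)
    (htr : ∀ (a : K i₀ →+* ℂ) (k : K i₀), a k ∈ normalClosure ℚ (K i₁) ℂ → k ∈ Set.range (algebraMap T (K i₀)))
    (htr' : ∀ (a : K' i₀ →+* ℂ) (k : K' i₀), a k ∈ normalClosure ℚ (K' i₁) ℂ →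
      k ∈ Set.range (algebraMap T (K' i₀)))
    {m d : ℕ} (hm : 1 ≤ m) (hmd : Module.finrank T (K i₀) = m * Module.finrank T (K' i₀) + 2 * d)
    (hlt : CMAlgebra.cmFamilyRank Φ' + Fintype.card I < (∑ i, cmTypeRank (Φ' i)) + 1) :
    ∃ Φ₀ : CMType (K i₀), CMAlgebra.cmFamilyRank (Function.update Φ i₀ Φ₀) + Fintype.card I <
      (∑ i, cmTypeRank (Function.update Φ i₀ Φ₀ i)) + 1 ∧
      cmTypeRank Φ₀ + CMAlgebra.cmFamilyRank Φ' = cmTypeRank (Φ' i₀) + CMAlgebra.cmFamilyRank (Function.update Φ i₀ Φ₀) := by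
  obtain ⟨Φ₀, h⟩ := exists_defect_eq_of_finrank_eq_mul_add h01 hI Φ Φ' e hΦ₁ htr htr' hm hmd
  refine ⟨Φ₀, ?_, h⟩
  rw [IrrOdd.sum_eq_add_of_pair _ hI h01, Function.update_self, Function.update_of_ne h01.symm]
  rw [IrrOdd.sum_eq_add_of_pair _ hI h01] at hlt
  have hr : cmTypeRank (Φ' i₁) = cmTypeRank (Φ i₁) := by
    change typeRank (ℂ ≃+* ℂ) (Φ' i₁).1 = typeRank (ℂ ≃+* ℂ) (Φ i₁).1
    rw [(isCMTypeWith_conj (Φ' i₁)).typeRank_eq_finrank_antiSpan_add_one,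
      (isCMTypeWith_conj (Φ i₁)).typeRank_eq_finrank_antiSpan_add_one,
      IrrOdd.finrank_antiSpan_eq_finrank_span_coeff, IrrOdd.finrank_antiSpan_eq_finrank_span_coeff,
      span_coeff_eq_of_ringEquiv e (Φ i₁) (Φ' i₁) hΦ₁]
  omega

end Transfer

end Summit.HodgeConjecture.CorCM

end
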